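import Literature.Topology.PlaneTopology.JordanSweepParity
import Literature.Probability.RandomPlanarGeometry.PlanarDomains
import Mathlib.Analysis.LocallyConvex.Separation
import Mathlib.Analysis.Normed.Module.Convex
import HarnessLib

/-!
# Nesting of Jordan loops: insides, outsides, diameters, plane homeomorphisms

Topic: Topology / PlaneTopology. PROOFS ONLY. Complements to the inside/outside API of
`IsJordanLoop` (`JordanSweepParity.lean`: `inside`, `outside`, `mem_inside_iff_wind_ne_zero`,
`subset_inside_or_subset_outside`, …), of the kind needed whenever several pairwise disjoint
Jordan curves are compared (loop ensembles of lattice models: the rounded interface loops of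
`Literature/Probability/Percolation/OrbitLoopPolygon.lean`; the transfer of crossing events in
`Literature.Probability.Percolation.dkkmo_crossing_rotation_invariance`):

* `IsJordanLoop.nonempty_inside`, `not_isBounded_outside`, `mem_outside_of_lt_norm`,
  `frontier_inside`, `frontier_outside`, `closure_inside_eq`, `closure_outside_eq` — both
  complementary domains are non-empty and have the curve as common frontier (Jordan curve
  theorem of the tree, `JordanCurveProof.exists_ne_connectedComponentIn`,
  `JordanCurveProof.frontier_connectedComponentIn_eq`);
* `IsJordanLoop.inside_subset_closure_convexHull`, `diam_inside_le` — the inside lies in the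
  closed convex hull of the curve (a point off it is joined to `∞` by a ray missing the curve,
  Hahn–Banach separation), so its diameter is at most that of the curve;
* **nesting** (`A`, `B` Jordan loops): `range A ⊆ inside B` gives `outside B ⊆ outside A`,
  `range B ⊆ outside A`, `inside A ⊆ inside B`, `diam (range A) ≤ diam (range B)` and excludes
  `range B ⊆ inside A`; `range A ⊆ outside B` together with `range B ⊆ outside A` gives disjoint
  insides; disjoint curves satisfy exactly one of the three alternatives
  (`IsJordanLoop.trichotomy`); a curve missing a curve of smaller diameter lies outside it
  (`range_subset_outside_of_diam_lt`);
* **plane homeomorphisms** `φ : ℂ ≃ₜ ℂ`: `φ ∘ γ` is a Jordan loop with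
  `inside (φ ∘ γ) = φ '' inside γ`, `outside (φ ∘ γ) = φ '' outside γ` (the outside is the
  unbounded complementary component and homeomorphisms of the plane preserve unboundedness),
  hence `wind (φ ∘ γ - φ z) ≠ 0 ↔ wind (γ - z) ≠ 0`;
* **bridge to `JordanDomain`** (`Literature/Probability/RandomPlanarGeometry/PlanarDomains.lean`):
  the boundary loop of a Jordan domain is a Jordan loop whose inside is the carrier and whose
  outside is the complement of the closed carrier; `z ∈ D.carrier ↔ wind (D.boundary - z) ≠ 0`
  off the frontier.

All statements are classical ([folklore]; method: Eilenberg 1936, McCleary 2006, Ch. 9).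

## References

* J. McCleary, *A First Course in Topology: Continuity and Dimension*, AMS (2006), Ch. 9
  (Jordan curve theorem, common boundary). [Mccleary2006]
* S. Eilenberg, *Transformations continues en circonférence et la topologie du plan*, Fund.
  Math. 26 (1936) (winding numbers and separation). [Eilenberg1936]
-/

noncomputable section

namespace Literature.Topology.PlaneTopology

open Complex Set Filter Metric Bornology Function
open _root_.Topology

namespace IsJordanLoop

variable {γ A B : ℝ → ℂ}

/-! ### Elementary complements -/

/-- Off the curve, not inside means outside. [folklore] -/
theorem mem_outside_iff_not_mem_inside {z : ℂ} (hz : z ∉ range γ) : z ∈ outside γ ↔ z ∉ inside γ := by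
  constructor
  · exact fun ho hi => Set.disjoint_left.1 disjoint_inside_outside hi ho
  · intro hi
    rcases mem_inside_or_mem_outside hz with h | h
    · exact (hi h).elim
    · exact h

/-- The inside is the complement of the curve minus the outside. [folklore] -/
theorem inside_eq_compl_diff_outside : inside γ = (range γ)ᶜ \ outside γ := by
  ext z
  constructor
  · exact fun hz => ⟨hz.1, fun ho => Set.disjoint_left.1 disjoint_inside_outside hz ho⟩
  · rintro ⟨hz, ho⟩
    rcases mem_inside_or_mem_outside (γ := γ) hz with h | h
    · exact h
    · exact (ho h).elim

/-- The curve, the inside and the outside cover the plane. [folklore] -/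
theorem mem_range_or_mem_inside_or_mem_outside (z : ℂ) : z ∈ range γ ∨ z ∈ inside γ ∨ z ∈ outside γ := by
  by_cases hz : z ∈ range γ
  · exact Or.inl hz
  · exact Or.inr (mem_inside_or_mem_outside hz)

/-- The inside misses the curve. [folklore] -/
theorem inside_subset_compl_range : inside γ ⊆ (range γ)ᶜ := fun _ hz => hz.1

/-- The outside misses the curve. [folklore] -/
theorem outside_subset_compl_range : outside γ ⊆ (range γ)ᶜ := fun _ hz => hz.1

/-- A ray `t ↦ z + t • v` (`t ≥ c`, `v ≠ 0`) is unbounded. [folklore] -/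
theorem not_isBounded_image_ray (z v : ℂ) (hv : v ≠ 0) (c : ℝ) :
    ¬ IsBounded ((fun t : ℝ => z + t • v) '' Ici c) := by
  intro hb
  obtain ⟨C, hC⟩ := hb.exists_norm_le
  have hvpos : 0 < ‖v‖ := norm_pos_iff.2 hv
  set t : ℝ := max c ((C + ‖z‖ + 1) / ‖v‖) with ht
  have htmem : z + t • v ∈ (fun t : ℝ => z + t • v) '' Ici c := ⟨t, Set.mem_Ici.2 (le_max_left _ _), rfl⟩
  have h1 : ‖z + t • v‖ ≤ C := hC _ htmem
  have h2 : (C + ‖z‖ + 1) / ‖v‖ ≤ t := le_max_right _ _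
  have h3 : C + ‖z‖ + 1 ≤ t * ‖v‖ := by rwa [div_le_iff₀ hvpos] at h2
  have h4 : ‖t • v‖ ≤ ‖z + t • v‖ + ‖z‖ := by
    calc ‖t • v‖ = ‖(z + t • v) - z‖ := by rw [add_sub_cancel_left]
      _ ≤ ‖z + t • v‖ + ‖z‖ := norm_sub_le _ _
  have htnn : 0 ≤ t := by
    have : 0 ≤ (C + ‖z‖ + 1) / ‖v‖ := by
      apply div_nonneg _ hvpos.le
      linarith [norm_nonneg z, (norm_nonneg _).trans (hC _ htmem)]
    exact this.trans h2
  rw [norm_smul, Real.norm_eq_abs, abs_of_nonneg htnn] at h4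
  linarith

/-- A ray is preconnected. [folklore] -/
theorem isPreconnected_image_ray (z v : ℂ) (c : ℝ) :
    IsPreconnected ((fun t : ℝ => z + t • v) '' Ici c) :=
  isPreconnected_Ici.image _ (by fun_prop)

/-- **Far points are outside**: if the curve lies in the closed ball `B̄(0, R)`, every point of
norm `> R` is outside (the ray from it away from the origin misses the curve). [folklore] -/
theorem mem_outside_of_lt_norm {R : ℝ} (hR : range γ ⊆ closedBall (0 : ℂ) R) {w : ℂ}
    (hw : R < ‖w‖) : w ∈ outside γ := by
  have hw0 : w ≠ 0 := by
    intro h; rw [h, norm_zero] at hw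
    exact (not_le.2 hw) ((norm_nonneg (γ 0)).trans (mem_closedBall_zero_iff.1 (hR ⟨0, rfl⟩)))
  have hsub : (fun t : ℝ => w + t • w) '' Ici 0 ⊆ (range γ)ᶜ := by
    rintro _ ⟨t, ht, rfl⟩ hmem
    have h1 : ‖w + t • w‖ ≤ R := mem_closedBall_zero_iff.1 (hR hmem)
    have h2 : w + t • w = (1 + t) • w := by rw [add_smul, one_smul]
    rw [h2, norm_smul, Real.norm_eq_abs, abs_of_nonneg (by linarith [mem_Ici.1 ht])] at h1
    have h3 : ‖w‖ ≤ (1 + t) * ‖w‖ := by nlinarith [norm_nonneg w, mem_Ici.1 ht]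
    linarith
  have key := subset_outside_of_isPreconnected (isPreconnected_image_ray w w 0) hsub
    (not_isBounded_image_ray w w hw0 0)
  exact key ⟨0, Set.mem_Ici.2 le_rfl, by simp⟩

/-- The outside is unbounded (in particular non-empty). [folklore] -/
theorem not_isBounded_outside (h : IsJordanLoop γ) : ¬ IsBounded (outside γ) := by
  intro hb
  obtain ⟨R, hR⟩ := (isBounded_iff_subset_closedBall 0).1 h.isCompact_range.isBounded
  obtain ⟨C, hC⟩ := hb.exists_norm_le
  set w : ℂ := ((max R C + 1 : ℝ) : ℂ) with hw
  have hnorm : ‖w‖ = max R C + 1 := by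
    rw [hw, Complex.norm_real, Real.norm_eq_abs, abs_of_pos]
    linarith [le_max_right R C, (norm_nonneg _).trans (hC _ (mem_outside_of_lt_norm hR
      (show R < ‖((R + 1 : ℝ) : ℂ)‖ by
        rw [Complex.norm_real, Real.norm_eq_abs, abs_of_pos] <;>
          linarith [(norm_nonneg (γ 0)).trans (mem_closedBall_zero_iff.1 (hR ⟨0, rfl⟩))])))]
  have hmem : w ∈ outside γ := mem_outside_of_lt_norm hR (by rw [hnorm]; linarith [le_max_left R C])
  have := hC w hmem
  rw [hnorm] at this
  linarith [le_max_right R C]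

/-- The outside is non-empty. [folklore] -/
theorem nonempty_outside (h : IsJordanLoop γ) : (outside γ).Nonempty := by
  by_contra hne
  rw [not_nonempty_iff_eq_empty] at hne
  exact h.not_isBounded_outside (by rw [hne]; exact isBounded_empty)

/-- **The inside is non-empty** (Jordan curve theorem: the complement has at least two
components, and all unbounded points lie in one of them). [cite: Mccleary2006, Ch. 9] -/
theorem nonempty_inside (h : IsJordanLoop γ) : (inside γ).Nonempty := by
  obtain ⟨e, -⟩ := exists_homeomorph_addCircle_forall_eq h.continuous h.periodic h.injOn
  obtain ⟨a, b, ha, hb, hab⟩ := JordanCurveProof.exists_ne_connectedComponentIn e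
  rcases mem_inside_or_mem_outside ha with hai | hao
  · exact ⟨a, hai⟩
  rcases mem_inside_or_mem_outside hb with hbi | hbo
  · exact ⟨b, hbi⟩
  exact (hab (by rw [← h.outside_eq_connectedComponentIn hao, ← h.outside_eq_connectedComponentIn hbo])).elim

/-- Inside and outside are different sets. [folklore] -/
theorem inside_ne_outside (h : IsJordanLoop γ) : inside γ ≠ outside γ := by
  intro heq
  obtain ⟨z, hz⟩ := h.nonempty_inside
  exact Set.disjoint_left.1 disjoint_inside_outside hz (heq ▸ hz)

/-- **Common boundary, inside**: the frontier of the inside is the curve. [cite: Mccleary2006, Ch. 9] -/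
theorem frontier_inside (h : IsJordanLoop γ) : frontier (inside γ) = range γ := by
  obtain ⟨e, -⟩ := exists_homeomorph_addCircle_forall_eq h.continuous h.periodic h.injOn
  obtain ⟨z, hz⟩ := h.nonempty_inside
  obtain ⟨b, hb⟩ := h.nonempty_outside
  rw [h.inside_eq_connectedComponentIn hz]
  refine JordanCurveProof.frontier_connectedComponentIn_eq e hz.1 ⟨b, hb.1, ?_⟩
  rw [← h.outside_eq_connectedComponentIn hb, ← h.inside_eq_connectedComponentIn hz]
  exact h.inside_ne_outside.symm

/-- **Common boundary, outside**: the frontier of the outside is the curve. [cite: Mccleary2006, Ch. 9] -/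
theorem frontier_outside (h : IsJordanLoop γ) : frontier (outside γ) = range γ := by
  obtain ⟨e, -⟩ := exists_homeomorph_addCircle_forall_eq h.continuous h.periodic h.injOn
  obtain ⟨z, hz⟩ := h.nonempty_inside
  obtain ⟨b, hb⟩ := h.nonempty_outside
  rw [h.outside_eq_connectedComponentIn hb]
  refine JordanCurveProof.frontier_connectedComponentIn_eq e hb.1 ⟨z, hz.1, ?_⟩
  rw [← h.outside_eq_connectedComponentIn hb, ← h.inside_eq_connectedComponentIn hz]
  exact h.inside_ne_outside

/-- The curve lies in the closure of the inside. [folklore] -/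
theorem range_subset_closure_inside (h : IsJordanLoop γ) : range γ ⊆ closure (inside γ) := by
  rw [← h.frontier_inside]; exact frontier_subset_closure

/-- The curve lies in the closure of the outside. [folklore] -/
theorem range_subset_closure_outside (h : IsJordanLoop γ) : range γ ⊆ closure (outside γ) := by
  rw [← h.frontier_outside]; exact frontier_subset_closure

/-- The closed outside is the outside together with the curve (at most). [folklore] -/
theorem closure_outside_subset (h : IsJordanLoop γ) : closure (outside γ) ⊆ outside γ ∪ range γ := by
  obtain ⟨z, hz⟩ := h.nonempty_outside
  intro w hw
  rw [h.outside_eq_connectedComponentIn hz] at hw ⊢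
  exact closure_connectedComponentIn_compl_subset h.isCompact_range.isClosed z hw

/-- The closed inside is exactly the inside together with the curve. [folklore] -/
theorem closure_inside_eq (h : IsJordanLoop γ) : closure (inside γ) = inside γ ∪ range γ :=
  (h.closure_inside_subset).antisymm (union_subset subset_closure h.range_subset_closure_inside)

/-- The closed outside is exactly the outside together with the curve. [folklore] -/
theorem closure_outside_eq (h : IsJordanLoop γ) : closure (outside γ) = outside γ ∪ range γ :=
  (h.closure_outside_subset).antisymm (union_subset subset_closure h.range_subset_closure_outside)

/-- The closed inside is preconnected. [folklore] -/
theorem isPreconnected_closure_inside (h : IsJordanLoop γ) : IsPreconnected (closure (inside γ)) :=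
  h.isPreconnected_inside.closure

/-! ### The inside lies in the convex hull of the curve -/

/-- **A point off the closed convex hull of the curve is outside**: a separating functional
gives a ray from the point to `∞` missing the hull. [folklore] -/
theorem mem_outside_of_not_mem_closure_convexHull {z : ℂ}
    (hz : z ∉ closure (convexHull ℝ (range γ))) : z ∈ outside γ := by
  set K : Set ℂ := closure (convexHull ℝ (range γ)) with hK
  have hKc : Convex ℝ K := (convex_convexHull ℝ _).closure
  obtain ⟨f, u, hfK, hfz⟩ := geometric_hahn_banach_closed_point hKc isClosed_closure hz
  set a₀ : ℂ := γ 0 with ha₀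
  have ha₀K : a₀ ∈ K := subset_closure (subset_convexHull ℝ _ ⟨0, rfl⟩)
  have hv : z - a₀ ≠ 0 := by
    intro hzero
    rw [sub_eq_zero] at hzero
    exact hz (hzero ▸ ha₀K)
  have hfv : 0 < f (z - a₀) := by
    rw [map_sub]; linarith [hfK a₀ ha₀K]
  have hsub : (fun t : ℝ => z + t • (z - a₀)) '' Ici 0 ⊆ (range γ)ᶜ := by
    rintro _ ⟨t, ht, rfl⟩ hmem
    have h1 : f (z + t • (z - a₀)) < u := hfK _ (subset_closure (subset_convexHull ℝ _ hmem))
    rw [map_add, map_smul, smul_eq_mul] at h1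
    nlinarith [mem_Ici.1 ht]
  exact subset_outside_of_isPreconnected (isPreconnected_image_ray z (z - a₀) 0) hsub
    (not_isBounded_image_ray z (z - a₀) hv 0) ⟨0, Set.mem_Ici.2 le_rfl, by simp⟩

/-- **The inside lies in the closed convex hull of the curve.** [folklore] -/
theorem inside_subset_closure_convexHull (γ : ℝ → ℂ) :
    inside γ ⊆ closure (convexHull ℝ (range γ)) := by
  intro z hz
  by_contra hzK
  exact Set.disjoint_left.1 disjoint_inside_outside hz (mem_outside_of_not_mem_closure_convexHull hzK)

/-- The closed inside lies in the closed convex hull of the curve. [folklore] -/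
theorem closure_inside_subset_closure_convexHull (γ : ℝ → ℂ) :
    closure (inside γ) ⊆ closure (convexHull ℝ (range γ)) :=
  closure_minimal (inside_subset_closure_convexHull γ) isClosed_closure

/-- **The inside is not wider than the curve**: `diam (inside γ) ≤ diam (range γ)`. [folklore] -/
theorem diam_inside_le (h : IsJordanLoop γ) : diam (inside γ) ≤ diam (range γ) := by
  have hb : IsBounded (closure (convexHull ℝ (range γ))) :=
    (isBounded_convexHull.2 h.isCompact_range.isBounded).closure
  calc diam (inside γ) ≤ diam (closure (convexHull ℝ (range γ))) :=
        diam_mono (inside_subset_closure_convexHull γ) hb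
    _ = diam (range γ) := by rw [diam_closure, convexHull_diam]

/-- The closed inside is not wider than the curve. [folklore] -/
theorem diam_closure_inside_le (h : IsJordanLoop γ) : diam (closure (inside γ)) ≤ diam (range γ) := by
  rw [diam_closure]; exact h.diam_inside_le

/-! ### Nesting of two Jordan loops -/

/-- The range of a loop is non-empty. [folklore] -/
theorem range_nonempty (γ : ℝ → ℂ) : (range γ).Nonempty := ⟨γ 0, 0, rfl⟩

/-- The range of a Jordan loop is preconnected. [folklore] -/
theorem isPreconnected_range (h : IsJordanLoop γ) : IsPreconnected (range γ) :=
  _root_.isPreconnected_range h.continuous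

/-- **Nested loops, outsides**: if `A` lies inside `B`, the outside of `B` lies outside `A`. [folklore] -/
theorem outside_subset_outside (hB : IsJordanLoop B) (h : range A ⊆ inside B) :
    outside B ⊆ outside A := by
  refine subset_outside_of_isPreconnected hB.isPreconnected_outside (fun z hz hzA => ?_)
    hB.not_isBounded_outside
  exact Set.disjoint_left.1 disjoint_inside_outside (h hzA) hz

/-- **Nested loops, the outer curve**: if `A` lies inside `B`, the curve `B` lies outside `A`. [folklore] -/
theorem range_subset_outside (hA : IsJordanLoop A) (hB : IsJordanLoop B) (h : range A ⊆ inside B) :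
    range B ⊆ outside A := by
  intro z hz
  have h1 : z ∈ closure (outside A) :=
    closure_mono (outside_subset_outside hB h) (hB.range_subset_closure_outside hz)
  rcases hA.closure_outside_subset h1 with ho | hr
  · exact ho
  · exact ((h hr).1 hz).elim

/-- **Nested loops, insides**: if `A` lies inside `B`, the inside of `A` lies inside `B`. [folklore] -/
theorem inside_subset_inside (hA : IsJordanLoop A) (hB : IsJordanLoop B) (h : range A ⊆ inside B) :
    inside A ⊆ inside B := by
  intro z hz
  have hzB : z ∉ range B := fun hzB =>
    Set.disjoint_left.1 disjoint_inside_outside hz (range_subset_outside hA hB h hzB)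
  rcases mem_inside_or_mem_outside hzB with hi | ho
  · exact hi
  · exact (Set.disjoint_left.1 disjoint_inside_outside hz (outside_subset_outside hB h ho)).elim

/-- Nested loops, closed insides. [folklore] -/
theorem closure_inside_subset_inside (hA : IsJordanLoop A) (hB : IsJordanLoop B)
    (h : range A ⊆ inside B) : closure (inside A) ⊆ inside B := by
  rw [hA.closure_inside_eq]
  exact union_subset (inside_subset_inside hA hB h) h

/-- **No mutual nesting**: `A` inside `B` excludes `B` inside `A`. [folklore] -/
theorem not_range_subset_inside (hA : IsJordanLoop A) (hB : IsJordanLoop B) (h : range A ⊆ inside B) :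
    ¬ range B ⊆ inside A := fun h' =>
  Set.disjoint_left.1 disjoint_inside_outside (h' ⟨0, rfl⟩) (range_subset_outside hA hB h ⟨0, rfl⟩)

/-- Nested loops, diameters of the curves: the inner curve is not wider. [folklore] -/
theorem diam_range_le_of_range_subset_inside (hB : IsJordanLoop B)
    (h : range A ⊆ inside B) : diam (range A) ≤ diam (range B) :=
  (diam_mono h hB.isBounded_inside).trans hB.diam_inside_le

/-- **Mutually exterior loops have disjoint insides.** [folklore] -/
theorem disjoint_inside_inside (hA : IsJordanLoop A) (hB : IsJordanLoop B)
    (hAB : range A ⊆ outside B) (hBA : range B ⊆ outside A) : Disjoint (inside A) (inside B) := by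
  rw [Set.disjoint_left]
  intro z hzA hzB
  -- the closed inside of `A` is preconnected, misses `B`, contains `z ∈ inside B` and `A ⊆ outside B`
  have hsub : closure (inside A) ⊆ (range B)ᶜ := by
    rw [hA.closure_inside_eq]
    rintro w (hw | hw) hwB
    · exact Set.disjoint_left.1 disjoint_inside_outside hw (hBA hwB)
    · exact (hAB hw).1 hwB
  rcases hB.subset_inside_or_subset_outside hA.isPreconnected_closure_inside hsub with hi | ho
  · exact Set.disjoint_left.1 disjoint_inside_outside (hi (hA.range_subset_closure_inside ⟨0, rfl⟩))
      (hAB ⟨0, rfl⟩)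
  · exact Set.disjoint_left.1 disjoint_inside_outside hzB (ho (subset_closure hzA))

/-- Mutually exterior loops: the closed inside of one misses the inside of the other. [folklore] -/
theorem disjoint_closure_inside_inside (hA : IsJordanLoop A) (hB : IsJordanLoop B)
    (hAB : range A ⊆ outside B) (hBA : range B ⊆ outside A) :
    Disjoint (closure (inside A)) (inside B) := by
  rw [hA.closure_inside_eq, disjoint_union_left]
  exact ⟨disjoint_inside_inside hA hB hAB hBA,
    Set.disjoint_left.2 fun w hw hwB => Set.disjoint_left.1 disjoint_inside_outside hwB (hAB hw)⟩

/-- **Trichotomy for disjoint Jordan loops**: one lies inside the other, or each lies outside the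
other. [folklore] -/
theorem trichotomy (hA : IsJordanLoop A) (hB : IsJordanLoop B) (h : Disjoint (range A) (range B)) :
    range A ⊆ inside B ∨ range B ⊆ inside A ∨ (range A ⊆ outside B ∧ range B ⊆ outside A) := by
  have hA' : range A ⊆ (range B)ᶜ := Set.disjoint_left.1 h
  have hB' : range B ⊆ (range A)ᶜ := Set.disjoint_right.1 h
  rcases hB.subset_inside_or_subset_outside hA.isPreconnected_range hA' with hi | ho
  · exact Or.inl hi
  rcases hA.subset_inside_or_subset_outside hB.isPreconnected_range hB' with hi' | ho'
  · exact Or.inr (Or.inl hi')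
  · exact Or.inr (Or.inr ⟨ho, ho'⟩)

/-- If `A` lies outside `B`, then `B` lies inside `A` or outside `A`; in the first case the
inside of `B` lies inside `A`. A convenient repackaging of the trichotomy. [folklore] -/
theorem range_subset_inside_or_disjoint_inside (hA : IsJordanLoop A) (hB : IsJordanLoop B)
    (hAB : range A ⊆ outside B) :
    (range B ⊆ inside A ∧ inside B ⊆ inside A) ∨ (range B ⊆ outside A ∧ Disjoint (inside A) (inside B)) := by
  have hdisj : Disjoint (range A) (range B) :=
    Set.disjoint_left.2 fun z hzA hzB => (hAB hzA).1 hzB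
  rcases trichotomy hA hB hdisj with hi | hi | ⟨-, ho⟩
  · exact (Set.disjoint_left.1 disjoint_inside_outside (hi ⟨0, rfl⟩) (hAB ⟨0, rfl⟩)).elim
  · exact Or.inl ⟨hi, inside_subset_inside hB hA hi⟩
  · exact Or.inr ⟨ho, disjoint_inside_inside hA hB hAB ho⟩

/-- **A curve missing a curve of smaller diameter lies outside it.** [folklore] -/
theorem range_subset_outside_of_diam_lt (hA : IsJordanLoop A) (hB : IsJordanLoop B)
    (h : Disjoint (range A) (range B)) (hd : diam (range B) < diam (range A)) :
    range A ⊆ outside B := by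
  rcases hB.subset_inside_or_subset_outside hA.isPreconnected_range (Set.disjoint_left.1 h) with hi | ho
  · exact absurd (diam_range_le_of_range_subset_inside hB hi) (not_le.2 hd)
  · exact ho

/-- A connected set missing a curve and wider than it lies outside it. [folklore] -/
theorem subset_outside_of_diam_lt (hB : IsJordanLoop B) {S : Set ℂ} (hS : IsPreconnected S)
    (hSB : S ⊆ (range B)ᶜ) (hd : diam (range B) < diam S) : S ⊆ outside B := by
  rcases hB.subset_inside_or_subset_outside hS hSB with hi | ho
  · exact absurd ((diam_mono hi hB.isBounded_inside).trans hB.diam_inside_le) (not_le.2 hd)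
  · exact ho

/-- If a connected set missing `B` meets the inside of `B`, it lies inside `B` together with
every loop it contains… in particular: if `range A ⊆ S`, `S` preconnected missing `B`, and `S`
meets `inside B`, then `range A ⊆ inside B`. [folklore] -/
theorem range_subset_inside_of_subset (hB : IsJordanLoop B) {S : Set ℂ} (hS : IsPreconnected S)
    (hSB : S ⊆ (range B)ᶜ) (hmeet : (S ∩ inside B).Nonempty) (hAS : range A ⊆ S) :
    range A ⊆ inside B := by
  rcases hB.subset_inside_or_subset_outside hS hSB with hi | ho
  · exact hAS.trans hi
  · obtain ⟨z, hzS, hzi⟩ := hmeet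
    exact (Set.disjoint_left.1 disjoint_inside_outside hzi (ho hzS)).elim

/-! ### Plane homeomorphisms preserve insides and outsides -/

/-- A homeomorphism of the plane maps unbounded sets to unbounded sets. [folklore] -/
theorem _root_.Homeomorph.not_isBounded_image (φ : ℂ ≃ₜ ℂ) {S : Set ℂ} (hS : ¬ IsBounded S) :
    ¬ IsBounded (φ '' S) := by
  intro hb
  obtain ⟨R, hR⟩ := (isBounded_iff_subset_closedBall 0).1 hb
  have hK : IsCompact (φ.symm '' closedBall (0 : ℂ) R) := (isCompact_closedBall 0 R).image φ.symm.continuous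
  refine hS (hK.isBounded.subset fun z hz => ?_)
  exact ⟨φ z, hR ⟨z, hz, rfl⟩, φ.symm_apply_apply z⟩

/-- The image of a Jordan loop under a plane homeomorphism is a Jordan loop. [folklore] -/
theorem comp_homeomorph (h : IsJordanLoop γ) (φ : ℂ ≃ₜ ℂ) : IsJordanLoop (φ ∘ γ) :=
  ⟨φ.continuous.comp h.continuous, fun t => by simp only [Function.comp_apply, h.periodic t],
    fun s hs t ht hst => h.injOn hs ht (φ.injective hst)⟩

/-- The range of the image loop. [folklore] -/
theorem range_comp_homeomorph (γ : ℝ → ℂ) (φ : ℂ ≃ₜ ℂ) : range (φ ∘ γ) = φ '' range γ :=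
  Set.range_comp φ γ

/-- The image of the outside lies in the outside of the image loop. [folklore] -/
theorem image_outside_subset (h : IsJordanLoop γ) (φ : ℂ ≃ₜ ℂ) :
    φ '' outside γ ⊆ outside (φ ∘ γ) := by
  refine subset_outside_of_isPreconnected (h.isPreconnected_outside.image φ φ.continuous.continuousOn)
    ?_ (φ.not_isBounded_image h.not_isBounded_outside)
  rintro _ ⟨z, hz, rfl⟩ hmem
  rw [range_comp_homeomorph] at hmem
  obtain ⟨w, hw, hwz⟩ := hmem
  exact hz.1 (φ.injective hwz ▸ hw)

/-- **Plane homeomorphisms preserve the outside**: `outside (φ ∘ γ) = φ '' outside γ`. [folklore] -/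
theorem outside_comp_homeomorph (h : IsJordanLoop γ) (φ : ℂ ≃ₜ ℂ) :
    outside (φ ∘ γ) = φ '' outside γ := by
  refine Subset.antisymm (fun z hz => ?_) (h.image_outside_subset φ)
  have h' := (h.comp_homeomorph φ).image_outside_subset φ.symm
  have hcomp : (φ.symm ∘ (φ ∘ γ)) = γ := by funext t; simp
  rw [hcomp] at h'
  exact ⟨φ.symm z, h' ⟨z, hz, rfl⟩, φ.apply_symm_apply z⟩

/-- **Plane homeomorphisms preserve the inside**: `inside (φ ∘ γ) = φ '' inside γ`. [folklore] -/
theorem inside_comp_homeomorph (h : IsJordanLoop γ) (φ : ℂ ≃ₜ ℂ) :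
    inside (φ ∘ γ) = φ '' inside γ := by
  rw [inside_eq_compl_diff_outside, inside_eq_compl_diff_outside, image_sdiff φ.injective,
    image_compl_eq φ.bijective, h.outside_comp_homeomorph φ, range_comp_homeomorph]

/-- Membership form: `φ z` is inside `φ ∘ γ` iff `z` is inside `γ`. [folklore] -/
theorem mem_inside_comp_homeomorph_iff (h : IsJordanLoop γ) (φ : ℂ ≃ₜ ℂ) {z : ℂ} :
    φ z ∈ inside (φ ∘ γ) ↔ z ∈ inside γ := by
  rw [h.inside_comp_homeomorph φ, φ.injective.mem_set_image]

/-- Membership form: `φ z` is outside `φ ∘ γ` iff `z` is outside `γ`. [folklore] -/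
theorem mem_outside_comp_homeomorph_iff (h : IsJordanLoop γ) (φ : ℂ ≃ₜ ℂ) {z : ℂ} :
    φ z ∈ outside (φ ∘ γ) ↔ z ∈ outside γ := by
  rw [h.outside_comp_homeomorph φ, φ.injective.mem_set_image]

/-- **Winding numbers under plane homeomorphisms**: `φ ∘ γ` winds about `φ z` iff `γ` winds
about `z` (both mean "inside"; the values agree up to the sign of `φ`, which is not asserted).
[cite: Eilenberg1936] -/
theorem wind_comp_homeomorph_ne_zero_iff (h : IsJordanLoop γ) (φ : ℂ ≃ₜ ℂ) {z : ℂ} (hz : z ∉ range γ) :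
    wind (fun t => φ (γ t) - φ z) ≠ 0 ↔ wind (fun t => γ t - z) ≠ 0 := by
  have hz' : φ z ∉ range (φ ∘ γ) := by
    rw [range_comp_homeomorph, φ.injective.mem_set_image]; exact hz
  have hfun : (fun t => φ (γ t) - φ z) = fun t => (φ ∘ γ) t - φ z := rfl
  rw [hfun, ← h.mem_inside_iff_wind_ne_zero hz, ← (h.comp_homeomorph φ).mem_inside_iff_wind_ne_zero hz']
  exact h.mem_inside_comp_homeomorph_iff φ

end IsJordanLoop

end Literature.Topology.PlaneTopology

/-! ### Bridge to `JordanDomain` -/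

namespace Literature.Probability.RandomPlanarGeometry.JordanDomain

open Complex Set Filter Metric Bornology Function
open _root_.Topology
open Literature.Topology.PlaneTopology

variable (D : JordanDomain)

/-- The boundary loop of a Jordan domain is a Jordan loop. [folklore] -/
theorem isJordanLoop_boundary : IsJordanLoop D.boundary :=
  ⟨D.continuous_boundary, D.periodic_boundary, D.injOn_boundary⟩

/-- The complementary component of a point of the domain, off the boundary curve, lies in the
domain (a preconnected set meeting an open set and missing its frontier stays in it). [folklore] -/
theorem connectedComponentIn_subset_carrier {z : ℂ} (hz : z ∈ D.carrier) :
    connectedComponentIn (range D.boundary)ᶜ z ⊆ D.carrier := by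
  have hU : IsOpen D.carrier := D.isOpen
  have hV : IsOpen (closure D.carrier)ᶜ := isClosed_closure.isOpen_compl
  have hUV : Disjoint D.carrier (closure D.carrier)ᶜ :=
    disjoint_compl_right.mono_left subset_closure
  refine isPreconnected_connectedComponentIn.subset_left_of_subset_union hU hV hUV ?_ ?_
  · intro w hw
    have hw' : w ∉ frontier D.carrier := by
      rw [← D.range_boundary]; exact connectedComponentIn_subset _ _ hw
    rw [hU.frontier_eq] at hw'
    by_cases hwc : w ∈ closure D.carrier
    · left; by_contra hwD; exact hw' ⟨hwc, hwD⟩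
    · right; exact hwc
  · refine ⟨z, mem_connectedComponentIn ?_, hz⟩
    rw [D.range_boundary, hU.frontier_eq]
    exact fun hz' => hz'.2 hz

/-- Points of the domain are inside the boundary loop. [folklore] -/
theorem carrier_subset_inside_boundary : D.carrier ⊆ IsJordanLoop.inside D.boundary := by
  intro z hz
  refine ⟨?_, D.isBounded.subset (D.connectedComponentIn_subset_carrier hz)⟩
  rw [D.range_boundary, D.isOpen.frontier_eq]
  exact fun hz' => hz'.2 hz

/-- **The inside of the boundary loop of a Jordan domain is the domain.** [folklore] -/
theorem inside_boundary_eq_carrier : IsJordanLoop.inside D.boundary = D.carrier := by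
  obtain ⟨z, hz⟩ := D.nonempty
  refine Subset.antisymm ?_ D.carrier_subset_inside_boundary
  rw [D.isJordanLoop_boundary.inside_eq_connectedComponentIn (D.carrier_subset_inside_boundary hz)]
  exact D.connectedComponentIn_subset_carrier hz

/-- **The outside of the boundary loop of a Jordan domain is the complement of its closure.** [folklore] -/
theorem outside_boundary_eq_compl_closure : IsJordanLoop.outside D.boundary = (closure D.carrier)ᶜ := by
  ext w
  rw [closure_eq_self_union_frontier, ← D.range_boundary, compl_union, mem_inter_iff, mem_compl_iff,
    mem_compl_iff, ← D.inside_boundary_eq_carrier]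
  constructor
  · exact fun hw => ⟨fun hi => Set.disjoint_left.1 IsJordanLoop.disjoint_inside_outside hi hw, hw.1⟩
  · rintro ⟨hi, hr⟩
    exact (IsJordanLoop.mem_outside_iff_not_mem_inside hr).2 hi

/-- **The domain read on winding numbers**: off the boundary, `z ∈ D` iff the boundary loop winds
about `z`. [cite: Eilenberg1936] -/
theorem mem_carrier_iff_wind_ne_zero {z : ℂ} (hz : z ∉ frontier D.carrier) :
    z ∈ D.carrier ↔ wind (fun t => D.boundary t - z) ≠ 0 := by
  rw [← D.inside_boundary_eq_carrier]
  exact D.isJordanLoop_boundary.mem_inside_iff_wind_ne_zero (by rwa [D.range_boundary])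

/-- Off the closed domain the boundary loop has winding number zero. [cite: Eilenberg1936] -/
theorem wind_boundary_sub_eq_zero {z : ℂ} (hz : z ∉ closure D.carrier) :
    wind (fun t => D.boundary t - z) = 0 := by
  have hz' : z ∈ IsJordanLoop.outside D.boundary := by rwa [D.outside_boundary_eq_compl_closure]
  exact (D.isJordanLoop_boundary.mem_outside_iff_wind_eq_zero hz'.1).1 hz'

/-- The closed domain is not wider than its boundary curve. [folklore] -/
theorem diam_closure_carrier_le : diam (closure D.carrier) ≤ diam (range D.boundary) := by
  rw [← D.inside_boundary_eq_carrier]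
  exact D.isJordanLoop_boundary.diam_closure_inside_le

end Literature.Probability.RandomPlanarGeometry.JordanDomain
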